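import Summits.HodgeConjecture.HodgeConjecture.Theorems.CyclicUnitaryPowersPLPackageOfNodalMeridian
import Summits.HodgeConjecture.HodgeConjecture.Theorems.CyclicUnitaryPowersMonodromyIsometry
import Summits.HodgeConjecture.HodgeConjecture.Theorems.CyclicUnitaryPowersDeckModelClauses
import Literature.AlgebraicGeometry.HodgeTheory.CyclicCoverNodalMeridianLocalMonodromy
import Literature.AlgebraicGeometry.HodgeTheory.CyclicCoverMonodromyCommutesDeck
import Literature.AlgebraicGeometry.HodgeTheory.CyclicReflectionRecognition
import Literature.AlgebraicGeometry.HodgeTheory.CyclicCoverDeckInvariantsTransfer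
import HarnessLib

/-!
# Crux K1-A, the `σ`-FREE LOCAL MONODROMY re-cut (I): a power of a nodal-meridian transport is the cyclic reflection
# (route `CyclicUnitaryPowers`, item stmt-HodgeConjecture-19544)

Prover seat `hodge-nonav-prover-Ax` (g9), cell `hodge-nonav`. Landed `--supports stmt-HodgeConjecture-19544`; sorry-free,
no definition, no new named fact here. CONDITIONAL results; nothing here says HC ∕ HC_AV is proved; rung F-H1 is not moved.

The registered binder `stub_ct99NodalMeridianReflection` of crux K1 is the nodal-centre meridian fact
`carlsonToledo1999_nodalMeridianMonodromy_isCyclicReflection` (CT99 §6 Proposition at a one-nodal centre: the meridian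
monodromy `T` IS the cyclic reflection — `τ` on the vanishing space `V`, identity on `V^⊥`). This file and its sequel
`CyclicUnitaryPowersPLPackageOfLocalMonodromy` re-cut it to the `σ`-FREE local monodromy fact
`carlsonToledo1999_nodalMeridianLocalMonodromy` (file `Literature/…/CyclicCoverNodalMeridianLocalMonodromy`:
`(T − 1)H² ⊆ V`, `Σ_{i<p} T^i|_V = 0`, `dim V = p − 1` — the monodromy of the surface singularity `y^p = uv`, no
covering group mentioned), the identification of `T|_V` with a power of the covering transformation being the tree's
RECOGNITION THEOREM (`CyclicReflectionRecognition.exists_pow_isCyclicReflection_of_commute`) fed by the tree theorems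
"the monodromy commutes with `τ`" (`CyclicCoverMonodromyCommutesDeck.ratTransport_comm_deck`), "`dim H²(X_F; ℚ)^σ = 1`"
(`carlsonToledo1999_finrank_eigenspace_deck_one_holds`), "`τ^p = 1`" (`pull_diagonalAut_pow_eq_one`), "`Γ ⊆ O(B)`"
(`transportedTraceForm_of_mem_ratMonodromyGroup`):

* §1 `carlsonToledo1999_nodalMeridianLocalMonodromy_of_nodalMeridianMonodromy` — the nodal REFLECTION fact implies the
  local-monodromy fact (the re-cut is weaker; the old binder keeps discharging the new one);
* §2 `exists_reflection_power_of_localMonodromy` — per meridian, `p` prime: from the local datum of a transport `T`, a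
  power `r = T^k ∈ Γ` is the cyclic reflection along `ℚ[τ]δ = range (T − 1)` and `T ∈ ⟨r⟩`.

## References

* [CarlsonToledo1999] J. A. Carlson, D. Toledo, Duke Math. J. 97 (1999), §2, §6 (kdoublept) and Proposition.
* [VoisinHodgeII2003] C. Voisin, Hodge Theory and Complex Algebraic Geometry II, §3.1.2, §6.2.1.
-/

noncomputable section

set_option linter.dupNamespace false

open CategoryTheory MvPolynomial _root_.Topology
open Literature.AlgebraicTopology.SingularHomology
open Literature.AlgebraicGeometry.Motives Literature.AlgebraicGeometry.Motives.UniversalHypersurface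
open Literature.AlgebraicGeometry.HodgeTheory Literature.AlgebraicGeometry.HodgeTheory.UniversalHypersurface
open Literature.AlgebraicGeometry.FundamentalGroup
open Summit.HodgeConjecture.HodgeConjecture.Theorems.SignSymmetricPowersMeridianMonodromy
open Summit.HodgeConjecture.HodgeConjecture.Theorems.CyclicUnitaryPowersPLPackageOfMeridians
open Summit.HodgeConjecture.HodgeConjecture.Theorems.CyclicUnitaryPowersNodalMeridianExists
open Summit.HodgeConjecture.HodgeConjecture.Theorems.CyclicUnitaryPowersMonodromyIsometry
open Summit.HodgeConjecture.HodgeConjecture.Theorems.CyclicUnitaryPowersDeckModelClauses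

namespace Summit.HodgeConjecture.HodgeConjecture.Theorems.CyclicUnitaryPowersLocalMonodromyReflection

/-! ### §0 Two sums -/

section Sums

variable {V : Type*} [AddCommGroup V] [Module ℚ V]

/-- If `Σ_{i<p} S^i c = 0` then `Σ_{i<p} S^{−i} c = 0` (`= S^{−(p−1)} Σ_{j<p} S^j c`, re-indexing `j = p−1−i`):
orientation of the meridian is irrelevant for the local datum. [cite: CarlsonToledo1999, §6 (held text p0014)] -/
theorem sum_inv_pow_apply_eq_zero (S : V ≃ₗ[ℚ] V) {p : ℕ} {c : V} (h : ∑ i ∈ Finset.range p, (S ^ i) c = 0) :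
    ∑ i ∈ Finset.range p, (S⁻¹ ^ i) c = 0 := by
  have key : ∀ i ∈ Finset.range p, (S⁻¹ ^ (p - 1 - i)) c = (S⁻¹ ^ (p - 1)) ((S ^ i) c) := by
    intro i hi
    rw [Finset.mem_range] at hi
    rw [← LinearEquiv.mul_apply]
    congr 1
    obtain ⟨m, hm⟩ : ∃ m, p - 1 = m + i := ⟨p - 1 - i, by omega⟩
    rw [hm, Nat.add_sub_cancel, pow_add, inv_pow S i, mul_assoc, inv_mul_cancel, mul_one]
  calc ∑ i ∈ Finset.range p, (S⁻¹ ^ i) c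
      = ∑ i ∈ Finset.range p, (S⁻¹ ^ (p - 1 - i)) c := (Finset.sum_range_reflect (fun i => (S⁻¹ ^ i) c) p).symm
    _ = ∑ i ∈ Finset.range p, (S⁻¹ ^ (p - 1)) ((S ^ i) c) := Finset.sum_congr rfl key
    _ = (S⁻¹ ^ (p - 1)) (∑ i ∈ Finset.range p, (S ^ i) c) := (map_sum _ _ _).symm
    _ = 0 := by rw [h, map_zero]

/-- If `T = τ` on `ℚ[τ]δ` and `Σ_{i<p} τ^i δ = 0`, then `Σ_{i<p} T^i = 0` on `ℚ[τ]δ` (`T^i = τ^i` there, `ℚ[τ]δ` being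
`τ`-stable). [cite: CarlsonToledo1999, §6 (held text p0013)] -/
theorem sum_pow_apply_eq_zero_of_eqOn_cyclicSpan {T τ : V ≃ₗ[ℚ] V} {p : ℕ} {δ : V}
    (hΦ : ∑ i ∈ Finset.range p, (τ ^ i) δ = 0) (hTτ : ∀ v ∈ cyclicSpan τ δ, T v = τ v)
    {v : V} (hv : v ∈ cyclicSpan τ δ) : ∑ i ∈ Finset.range p, (T ^ i) v = 0 := by
  have hpow : ∀ (i : ℕ), ∀ w ∈ cyclicSpan τ δ, (T ^ i) w = (τ ^ i) w := by
    intro i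
    induction i with
    | zero => intro w _; rw [pow_zero, pow_zero]
    | succ i ih =>
      intro w hw
      rw [pow_succ, pow_succ, LinearEquiv.mul_apply, LinearEquiv.mul_apply, hTτ w hw,
        ih _ (apply_mem_cyclicSpan τ δ hw)]
  rw [Finset.sum_congr rfl fun i _ => hpow i v hv]
  exact sum_pow_apply_eq_zero_of_mem_cyclicSpan τ hΦ hv

end Sums

/-! ### §1 The re-cut is weaker: the nodal reflection fact implies the local-monodromy fact -/

/-- **The nodal-centre REFLECTION fact implies the `σ`-free local-monodromy fact**: with `T'` (`= T` or `T⁻¹`) the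
cyclic reflection along `V = ℚ[τ]δ`, `(T − 1)H = V` (`range_sub_id_eq_cyclicSpan`, `range_inv_sub_id_eq`),
`Σ_{i<p} T^i = 0` on `V` (`T'|_V = τ|_V`, `Σ τ^i δ = 0`; for `T = T'⁻¹` re-index) and `dim V = p − 1`. So the old binder
still discharges the new one. [cite: CarlsonToledo1999, §6 (kdoublept) and Proposition (held text p0013–p0014)] -/
theorem carlsonToledo1999_nodalMeridianLocalMonodromy_of_nodalMeridianMonodromy
    (H : carlsonToledo1999_nodalMeridianMonodromy_isCyclicReflection) :
    carlsonToledo1999_nodalMeridianLocalMonodromy := by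
  intro p _ hodd h3 f hf hf0 hX D hD hDeq χ hχ μ hμ γ hγ
  have hp2 : 2 ≤ p := by omega
  have hp0 : p ≠ 0 := by omega
  have hJ := CyclicCoverFormNonsingular.isNonsingularForm_cyclicCoverForm_of_isSmoothProjective hp2 hf hf0 hX
  obtain ⟨e, he⟩ := exists_isCompatibleFibreIso p hf hJ
  obtain ⟨τ, hτ⟩ := exists_deck_intertwining e
  obtain ⟨T, δ, hT, -, hΦ, hdim, hnd, hrefl⟩ := H hodd h3 f hf hf0 hX e he τ hτ D hD hDeq χ hχ μ hμ γ hγ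
  haveI : Module.Finite ℚ (bettiCohomology (fiberOver (cyclicCoverFamily p) (cyclicCoverPoint p f)) 2) :=
    BettiUniverse.finite ((isSmoothProjectiveFamily_cyclicCoverFamily p).isSmoothProjective (cyclicCoverPoint p f)) 2
  have hBs : (transportedTraceForm hX e 2).IsSymm := transportedTraceForm_isSymm hX e (by decide)
  refine ⟨T, cyclicSpan τ δ, hT, fun x => ?_, fun v hv => ?_, hdim⟩
  · rcases hrefl with hr | hr
    · rw [← range_sub_id_eq_cyclicSpan hBs hp0 hΦ hnd hr]
      exact ⟨x, rfl⟩
    · rw [← range_sub_id_eq_cyclicSpan hBs hp0 hΦ hnd hr, range_inv_sub_id_eq]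
      exact ⟨x, rfl⟩
  · rcases hrefl with hr | hr
    · exact sum_pow_apply_eq_zero_of_eqOn_cyclicSpan hΦ hr.1 hv
    · have h := sum_inv_pow_apply_eq_zero T⁻¹ (sum_pow_apply_eq_zero_of_eqOn_cyclicSpan hΦ hr.1 hv)
      rwa [inv_inv] at h

/-! ### §2 Per meridian: a power of the transport is the cyclic reflection -/

section PerMeridian

variable {p : ℕ} [NeZero p] {f : MvPolynomial (Fin 3) ℂ}

/-- **From the local datum of a meridian transport to the cyclic reflection (a power of it).** For `p` prime,
`p ≥ 3`, a transport `T` of a loop at `[F]` with vanishing space `V` (`T x − x ∈ V`, `Σ_{i<p} T^i|_V = 0`,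
`dim V = p − 1`): `T ∈ Γ` preserves the cup form `B` (`transportedTraceForm_of_mem_ratMonodromyGroup`), commutes with
`τ` (`ratTransport_comm_deck`), `τ^p = 1` (`pull_diagonalAut_pow_eq_one`), `dim V^τ = 1 < p − 1`
(`carlsonToledo1999_finrank_eigenspace_deck_one_holds`); so the recognition theorem
`exists_pow_isCyclicReflection_of_commute` gives `r = T^k ∈ Γ` with `T ∈ ⟨r⟩`, `IsCyclicReflection B τ δ r` along
`ℚ[τ]δ = V = range (T − 1)` with all §6 clauses. [cite: CarlsonToledo1999, §6 (kdoublept) and Proposition (held text p0013–p0014), §2 (p0005)] -/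
theorem exists_reflection_power_of_localMonodromy (hp : p.Prime) (h3 : 3 ≤ p) (hf : f.IsHomogeneous p) (hf0 : f ≠ 0)
    (hX : IsSmoothProjective 2 (SmoothHypersurface.hypersurface (cyclicCoverForm p f)))
    (e : fiberOver (cyclicCoverFamily p) (cyclicCoverPoint p f) ≅ SmoothHypersurface.hypersurface (cyclicCoverForm p f))
    (he : IsCompatibleFibreIso p e)
    (τ : bettiCohomology (fiberOver (cyclicCoverFamily p) (cyclicCoverPoint p f)) 2 ≃ₗ[ℚ]
      bettiCohomology (fiberOver (cyclicCoverFamily p) (cyclicCoverPoint p f)) 2)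
    (hτ : ∀ (ha : deckUnit p ∈ diagonalStabilizer (cyclicCoverForm p f))
      (x : bettiCohomology (fiberOver (cyclicCoverFamily p) (cyclicCoverPoint p f)) 2),
      BettiUniverse.pullEquiv e 2 (τ x) =
        BettiUniverse.pull (diagonalAut (cyclicCoverForm p f) ha) 2 (BettiUniverse.pullEquiv e 2 x))
    {γ : Path (cyclicCoverPoint p f) (cyclicCoverPoint p f)}
    {T : bettiCohomology (fiberOver (cyclicCoverFamily p) (cyclicCoverPoint p f)) 2 ≃ₗ[ℚ]
      bettiCohomology (fiberOver (cyclicCoverFamily p) (cyclicCoverPoint p f)) 2}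
    (hT : IsRatTransport (cyclicCoverFamily p) 2 (cyclicCoverFamily_locallyTrivial p) (cyclicCoverLoopClass p γ) T)
    {W : Submodule ℚ (bettiCohomology (fiberOver (cyclicCoverFamily p) (cyclicCoverPoint p f)) 2)}
    (hrange : ∀ x, T x - x ∈ W) (hsum : ∀ w ∈ W, ∑ i ∈ Finset.range p, (T ^ i) w = 0)
    (hdim : Module.finrank ℚ W = p - 1) :
    ∃ (r : bettiCohomology (fiberOver (cyclicCoverFamily p) (cyclicCoverPoint p f)) 2 ≃ₗ[ℚ]
        bettiCohomology (fiberOver (cyclicCoverFamily p) (cyclicCoverPoint p f)) 2)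
      (δ : bettiCohomology (fiberOver (cyclicCoverFamily p) (cyclicCoverPoint p f)) 2),
      r ∈ ratMonodromyGroup (cyclicCoverFamily p) 2 (cyclicCoverFamily_locallyTrivial p)
        ⟨cyclicCoverPoint p f, Set.mem_univ _⟩ ∧
      T ∈ Subgroup.zpowers r ∧
      δ ≠ 0 ∧ (∑ i ∈ Finset.range p, (τ ^ i) δ) = 0 ∧
      Module.finrank ℚ (cyclicSpan τ δ) = p - 1 ∧
      (∀ x ∈ cyclicSpan τ δ, (∀ y ∈ cyclicSpan τ δ, transportedTraceForm hX e 2 x y = 0) → x = 0) ∧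
      IsCyclicReflection (transportedTraceForm hX e 2) τ δ r ∧
      LinearMap.range ((T : _ →ₗ[ℚ] _) - LinearMap.id) = cyclicSpan τ δ := by
  have hp2 : 2 ≤ p := by omega
  have hJ := CyclicCoverFormNonsingular.isNonsingularForm_cyclicCoverForm_of_isSmoothProjective hp2 hf hf0 hX
  haveI : Module.Finite ℚ (bettiCohomology (fiberOver (cyclicCoverFamily p) (cyclicCoverPoint p f)) 2) :=
    BettiUniverse.finite ((isSmoothProjectiveFamily_cyclicCoverFamily p).isSmoothProjective (cyclicCoverPoint p f)) 2
  have hBs : (transportedTraceForm hX e 2).IsSymm := transportedTraceForm_isSymm hX e (by decide)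
  have hBnd : (transportedTraceForm hX e 2).Nondegenerate := transportedTraceForm_nondegenerate hX e
  -- `T ∈ Γ ⊆ O(B)`
  have hTΓ : T ∈ ratMonodromyGroup (cyclicCoverFamily p) 2 (cyclicCoverFamily_locallyTrivial p)
      ⟨cyclicCoverPoint p f, Set.mem_univ _⟩ := mem_ratMonodromyGroup_of_isRatTransport _ _ _ hT
  have hTiso : ∀ x y, transportedTraceForm hX e 2 (T x) (T y) = transportedTraceForm hX e 2 x y :=
    transportedTraceForm_of_mem_ratMonodromyGroup hf hX hJ e hTΓ
  -- `T τ = τ T`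
  have hcommeq : T * τ = τ * T := CyclicCoverScaling.ratTransport_comm_deck hp2 hf hf0 hX e he τ hτ γ hT
  have hcomm : ∀ x, T (τ x) = τ (T x) := fun x => LinearEquiv.congr_fun hcommeq x
  -- `τ^p = 1`
  have ha : deckUnit p ∈ diagonalStabilizer (cyclicCoverForm p f) := deckUnit_mem_diagonalStabilizer (NeZero.ne p) f
  have hσp : BettiUniverse.pull (diagonalAut (cyclicCoverForm p f) ha) 2 ^ p = 1 :=
    pull_diagonalAut_pow_eq_one _ ha (deckUnit_pow_self hp.ne_zero) 2
  have hτi : ∀ (i : ℕ) (x : bettiCohomology (fiberOver (cyclicCoverFamily p) (cyclicCoverPoint p f)) 2),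
      BettiUniverse.pullEquiv e 2 ((τ ^ i) x) =
        (BettiUniverse.pull (diagonalAut (cyclicCoverForm p f) ha) 2 ^ i) (BettiUniverse.pullEquiv e 2 x) := by
    intro i
    induction i with
    | zero => intro x; rw [pow_zero, pow_zero, Module.End.one_apply]; rfl
    | succ i ih => intro x; rw [pow_succ, pow_succ, LinearEquiv.mul_apply, Module.End.mul_apply, ih, hτ ha]
  have hτp : τ ^ p = 1 := by
    refine LinearEquiv.ext fun x => (BettiUniverse.pullEquiv e 2).injective ?_
    rw [hτi, hσp, Module.End.one_apply]
    rfl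
  -- `dim V^τ = 1 < p − 1`
  have hmap : (Module.End.eigenspace (τ : bettiCohomology (fiberOver (cyclicCoverFamily p) (cyclicCoverPoint p f)) 2 →ₗ[ℚ]
        bettiCohomology (fiberOver (cyclicCoverFamily p) (cyclicCoverPoint p f)) 2) 1).map
      (BettiUniverse.pullEquiv e 2 : bettiCohomology (fiberOver (cyclicCoverFamily p) (cyclicCoverPoint p f)) 2 →ₗ[ℚ]
        bettiCohomology (SmoothHypersurface.hypersurface (cyclicCoverForm p f)) 2) =
      Module.End.eigenspace (BettiUniverse.pull (diagonalAut (cyclicCoverForm p f) ha) 2) 1 := by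
    ext y
    simp only [Submodule.mem_map, Module.End.mem_eigenspace_iff, one_smul, LinearEquiv.coe_coe]
    constructor
    · rintro ⟨x, hx, rfl⟩
      rw [← hτ ha]
      exact congrArg _ hx
    · intro hy
      refine ⟨(BettiUniverse.pullEquiv e 2).symm y, ?_, LinearEquiv.apply_symm_apply _ y⟩
      apply (BettiUniverse.pullEquiv e 2).injective
      change BettiUniverse.pullEquiv e 2 (τ _) = _
      rw [hτ ha, LinearEquiv.apply_symm_apply, hy]
  have hfix1 : Module.finrank ℚ ↥(Module.End.eigenspace
      (τ : bettiCohomology (fiberOver (cyclicCoverFamily p) (cyclicCoverPoint p f)) 2 →ₗ[ℚ]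
        bettiCohomology (fiberOver (cyclicCoverFamily p) (cyclicCoverPoint p f)) 2) 1) = 1 := by
    rw [← LinearEquiv.finrank_map_eq (BettiUniverse.pullEquiv e 2), hmap]
    exact carlsonToledo1999_finrank_eigenspace_deck_one_holds h3 f hf hf0 hX ha
  have hfix : Module.finrank ℚ ↥(Module.End.eigenspace
      (τ : bettiCohomology (fiberOver (cyclicCoverFamily p) (cyclicCoverPoint p f)) 2 →ₗ[ℚ]
        bettiCohomology (fiberOver (cyclicCoverFamily p) (cyclicCoverPoint p f)) 2) 1) < p - 1 := by
    rw [hfix1]; omega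
  -- `V ≠ 0`
  have hW0 : W ≠ ⊥ := by
    intro h
    rw [h, finrank_bot] at hdim
    omega
  -- the recognition theorem
  obtain ⟨k, δ, h0, hΦ, hfr, hnd, hrefl, hzp, hCW, hRW⟩ :=
    exists_pow_isCyclicReflection_of_commute hp (transportedTraceForm hX e 2) hBnd hBs T τ hTiso hcomm hτp hfix W
      hrange hsum hdim.le hW0
  exact ⟨T ^ k, δ, Subgroup.pow_mem _ hTΓ k, hzp, h0, hΦ, hfr, hnd, hrefl, by rw [hRW, hCW]⟩

end PerMeridian

end Summit.HodgeConjecture.HodgeConjecture.Theorems.CyclicUnitaryPowersLocalMonodromyReflection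

end
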